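import Summits.PneNP.PneNP.Theorems.ExpanderLinearGeneratorsGridRoutingSystem
import Summits.PneNP.PneNP.Theorems.ExpanderLinearGeneratorsSkeletonSteps

/-!
# PneNP / ExpanderLinearGenerators — the routing substitution and its skeletons (grid routing
reduction, formulas)

Route `PneNP/ExpanderLinearGenerators`, support for crux stmt-PneNP-11443. Second file of the
Urquhart–Fu / Ben-Sasson reduction of the bijective pigeonhole principle `ontoPHP^{k+2}_{k+1}`
to the Tseitin system of the routing grid (`…GridRoutingSystem`): the SUBSTITUTION that a
bijection induces on the edge variables, and the constant-size SKELETONS through which every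
substituted Tseitin clause follows from pigeonhole clauses.

* `rowOR k u w = ⋁_{w' ∈ [w, k+1)} p_{u w'}` ("pigeon `u` is routed through the row edge
  `r(u,w)`", i.e. `f u ≥ w`), `colOR k u w = ⋁_{u' ∈ [u, k+2)} p_{u' w}` ("the column edge
  `c(u,w)` is used", i.e. hole `w` receives a pigeon `≥ u`); `rowOR k u 0` / `colOR k 0 w` ARE the
  rendered pigeon / onto clauses, and `rowOR k u w = p_{uw} ∨ rowOR k u (w+1)`,
  `colOR k u w = p_{uw} ∨ colOR k (u+1) w` SYNTACTICALLY;
* `routeSubst k` — the substitution `r(u,w) ↦ rowOR k u w`, `c(u,w) ↦ colOR k u w`;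
* `skelSubst k u w` / `fillSubst k u w` — at the grid point `g(u,w)` the four edges are the
  instances under `fillSubst` (`0 ↦ p_{uw}`, `1 ↦ rowOR k u (w+1)`, `2 ↦ colOR k (u+1) w`) of the
  skeleton `r(u,w) ↦ x₀ ∨ x₁`, `r(u,w+1) ↦ x₁`, `c(u,w) ↦ x₀ ∨ x₂`, `c(u+1,w) ↦ x₂` (a missing
  edge contributes `⊥`): `subst_skelSubst_fillSubst`;
* `skel_tautology_grid` — **the combinatorial heart**: under the skeleton, every clause of the
  equation of `g(u,w)` is TRUE whenever `¬(x₀ ∧ x₁)` and `¬(x₀ ∧ x₂)` (functionality and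
  injectivity): `(x₀ ∨ x₁) + x₁ + (x₀ ∨ x₂) + x₂ ≡ 0`; `skel_tautology_pigeon`,
  `skel_tautology_hole` — at a terminal the single edge carries the pigeon / onto clause, value
  `1 =` charge.

References: A. Urquhart, X. Fu, NDJFL 37 (1996); E. Ben-Sasson, Comput. Complexity 11 (2002),
§3 (the reduction from the onto pigeonhole principle by routing).
-/

namespace Summit.PneNP.PneNP.Theorems.GridRouting

set_option linter.dupNamespace false -- `Summit.PneNP.PneNP.…`: summit = sub-problem (D-0017)

open Finset Literature.Computability.Complexity.PropForm
open Literature.Computability.Complexity (PropForm Clause CNF Literal eventually_pow_lt_two_rpow_rpow)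
open Literature.Computability.MetaComplexity Literature.Computability.MetaComplexity.TextbookFrege
open Literature.Computability.MetaComplexity.KrajicekRamsey (litOf clauseOf)

variable (k : ℕ)

/-! ### The routing formulas -/

variable {k}

/-- `rowOR k u w = p_{uw} ∨ rowOR k u (w+1)`, syntactically. [folklore] -/
theorem rowOR_step {u w : ℕ} (hw : w < k + 1) :
    rowOR k u w = disj (var (u * (k + 1) + w)) (rowOR k u (w + 1)) := by
  unfold rowOR
  obtain ⟨m, hm⟩ : ∃ m, k + 1 - w = m + 1 := ⟨k - w, by omega⟩
  rw [hm, List.range'_succ, List.map_cons, clauseOf_cons, litOf_true,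
    show k + 1 - (w + 1) = m by omega]

/-- Beyond the last hole the row formula is `⊥`. [folklore] -/
theorem rowOR_end {u w : ℕ} (hw : k + 1 ≤ w) : rowOR k u w = const false := by
  unfold rowOR
  rw [show k + 1 - w = 0 by omega, List.range'_zero, List.map_nil, clauseOf_nil]

/-- `colOR k u w = p_{uw} ∨ colOR k (u+1) w`, syntactically. [folklore] -/
theorem colOR_step {u w : ℕ} (hu : u < k + 2) :
    colOR k u w = disj (var (u * (k + 1) + w)) (colOR k (u + 1) w) := by
  unfold colOR
  obtain ⟨m, hm⟩ : ∃ m, k + 2 - u = m + 1 := ⟨k + 1 - u, by omega⟩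
  rw [hm, List.range'_succ, List.map_cons, clauseOf_cons, litOf_true,
    show k + 2 - (u + 1) = m by omega]

/-- Beyond the last pigeon the column formula is `⊥`. [folklore] -/
theorem colOR_end {u w : ℕ} (hu : k + 2 ≤ u) : colOR k u w = const false := by
  unfold colOR
  rw [show k + 2 - u = 0 by omega, List.range'_zero, List.map_nil, clauseOf_nil]

/-- `rowOR k u 0` is the rendered pigeon clause of `u`. [folklore] -/
theorem rowOR_zero (u : ℕ) :
    rowOR k u 0 = clauseOf ((List.range (k + 1)).map fun j => (u * (k + 1) + j, true)) := by
  unfold rowOR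
  rw [Nat.sub_zero, List.range_eq_range']

/-- `colOR k 0 w` is the rendered onto clause of `w`. [folklore] -/
theorem colOR_zero (w : ℕ) :
    colOR k 0 w = clauseOf ((List.range (k + 2)).map fun i => (i * (k + 1) + w, true)) := by
  unfold colOR
  rw [Nat.sub_zero, List.range_eq_range']

/-- Size of a row formula. [folklore] -/
theorem size_rowOR_le (u w : ℕ) : (rowOR k u w).size ≤ 2 * (k + 2) + 1 := by
  unfold rowOR
  rw [size_clauseOf_map_true, List.length_range']
  omega

/-- Size of a column formula. [folklore] -/
theorem size_colOR_le (u w : ℕ) : (colOR k u w).size ≤ 2 * (k + 2) + 1 := by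
  unfold colOR
  rw [size_clauseOf_map_true, List.length_range']
  omega

/-- Semantics of a row formula. [folklore] -/
theorem eval_rowOR (σ : ℕ → Bool) (u w : ℕ) :
    (rowOR k u w).eval σ = true ↔ ∃ w', w ≤ w' ∧ w' < k + 1 ∧ σ (u * (k + 1) + w') = true := by
  unfold rowOR
  rw [eval_clauseOf, List.any_eq_true]
  constructor
  · rintro ⟨l, hl, h⟩
    obtain ⟨w', hw', rfl⟩ := List.mem_map.1 hl
    rw [List.mem_range'_1] at hw'
    exact ⟨w', hw'.1, by omega, by simpa [Literal.eval] using h⟩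
  · rintro ⟨w', h1, h2, h⟩
    refine ⟨(u * (k + 1) + w', true), List.mem_map.2 ⟨w', List.mem_range'_1.2 ⟨h1, by omega⟩, rfl⟩,
      ?_⟩
    simpa [Literal.eval] using h

/-- Semantics of a column formula. [folklore] -/
theorem eval_colOR (σ : ℕ → Bool) (u w : ℕ) :
    (colOR k u w).eval σ = true ↔ ∃ u', u ≤ u' ∧ u' < k + 2 ∧ σ (u' * (k + 1) + w) = true := by
  unfold colOR
  rw [eval_clauseOf, List.any_eq_true]
  constructor
  · rintro ⟨l, hl, h⟩
    obtain ⟨u', hu', rfl⟩ := List.mem_map.1 hl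
    rw [List.mem_range'_1] at hu'
    exact ⟨u', hu'.1, by omega, by simpa [Literal.eval] using h⟩
  · rintro ⟨u', h1, h2, h⟩
    refine ⟨(u' * (k + 1) + w, true), List.mem_map.2 ⟨u', List.mem_range'_1.2 ⟨h1, by omega⟩, rfl⟩,
      ?_⟩
    simpa [Literal.eval] using h

variable (k)

/-- The routing substitution on an edge variable. [folklore] -/
theorem routeSubst_varEquiv (e : VarIdx k) : routeSubst k (varEquiv k e) = routeOf k e := by
  unfold routeSubst
  rw [dif_pos (varEquiv k e).2]
  simp

/-- Size bound for the routing substitution. [folklore] -/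
theorem size_routeSubst_le (x : ℕ) : (routeSubst k x).size ≤ 2 * (k + 2) + 1 := by
  unfold routeSubst
  split_ifs with h
  · rcases (varEquiv k).symm ⟨x, h⟩ with ⟨u, w⟩ | ⟨u, w⟩
    · exact size_rowOR_le _ _
    · exact size_colOR_le _ _
  · simp [size]

/-- Depth bound for the routing substitution. [folklore] -/
theorem altDepthAux_routeSubst_le (x t : ℕ) : altDepthAux t (routeSubst k x) ≤ 2 := by
  unfold routeSubst
  split_ifs with h
  · rcases (varEquiv k).symm ⟨x, h⟩ with ⟨u, w⟩ | ⟨u, w⟩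
    · exact altDepthAux_clauseOf_le _ _
    · exact altDepthAux_clauseOf_le _ _
  · simp [altDepthAux]

/-! ### The skeleton at a grid point -/

variable {k}

/-- The skeleton substitution on an edge variable. [folklore] -/
theorem skelSubst_varEquiv (u : Fin (k + 2)) (w : Fin (k + 1)) (e : VarIdx k) :
    skelSubst k u w (varEquiv k e) = skelOf k u w e := by
  unfold skelSubst
  rw [dif_pos (varEquiv k e).2]
  simp

/-- Values of the filling. [folklore] -/
theorem fillSubst_zero (u : Fin (k + 2)) (w : Fin (k + 1)) :
    fillSubst k u w 0 = var ((u : ℕ) * (k + 1) + w) := rfl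

/-- Values of the filling. [folklore] -/
theorem fillSubst_one (u : Fin (k + 2)) (w : Fin (k + 1)) :
    fillSubst k u w 1 = rowOR k u (w + 1) := rfl

/-- Values of the filling. [folklore] -/
theorem fillSubst_two (u : Fin (k + 2)) (w : Fin (k + 1)) :
    fillSubst k u w 2 = colOR k (u + 1) w := rfl

/-- Size bound for the filling. [folklore] -/
theorem size_fillSubst_le (u : Fin (k + 2)) (w : Fin (k + 1)) (y : ℕ) :
    (fillSubst k u w y).size ≤ 2 * (k + 2) + 1 := by
  unfold fillSubst
  split_ifs
  · simp [size]
  · exact size_rowOR_le _ _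
  · exact size_colOR_le _ _
  · simp [size]

/-- Depth bound for the filling. [folklore] -/
theorem altDepthAux_fillSubst_le (u : Fin (k + 2)) (w : Fin (k + 1)) (y t : ℕ) :
    altDepthAux t (fillSubst k u w y) ≤ 2 := by
  unfold fillSubst
  split_ifs
  · simp [altDepthAux]
  · exact altDepthAux_clauseOf_le _ _
  · exact altDepthAux_clauseOf_le _ _
  · simp [altDepthAux]

/-- **Skeleton and filling compose to the routing substitution** on the edges of `g(u,w)`.
[folklore] -/
theorem subst_skelOf_fillSubst (u : Fin (k + 2)) (w : Fin (k + 1)) {e : VarIdx k}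
    (he : e ∈ edgesOf k (Sum.inr (Sum.inr (u, w)))) :
    (skelOf k u w e).subst (fillSubst k u w) = routeOf k e := by
  rcases e with ⟨a, b⟩ | ⟨a, b⟩
  · obtain ⟨hau, hb⟩ := inl_mem_edgesOf_grid.1 he
    subst hau
    rcases hb with hbw | hb
    · -- the left edge `r(u,w)`
      subst hbw
      simp only [skelOf, and_self, if_true, routeOf]
      rw [rowOR_step b.2]
      by_cases h : (b : ℕ) + 1 < k + 1
      · rw [if_pos h]; rfl
      · rw [if_neg h]
        simp only [PropForm.subst, fillSubst_zero]
        rw [rowOR_end (by omega)]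
    · -- the right edge `r(u,w+1)`
      have hbw : b ≠ w := fun h => by have := congrArg Fin.val h; omega
      have e1 : skelOf k a w (Sum.inl (a, b)) = var 1 := by simp [skelOf, hbw, hb]
      rw [e1]
      simp only [PropForm.subst, fillSubst_one, routeOf]
      rw [hb]
  · obtain ⟨hbw, ha⟩ := inr_mem_edgesOf_grid.1 he
    subst hbw
    rcases ha with hau | ha
    · -- the upper edge `c(u,w)`
      subst hau
      simp only [skelOf, and_self, if_true, routeOf]
      rw [colOR_step a.2]
      by_cases h : (a : ℕ) + 1 < k + 2
      · rw [if_pos h]; rfl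
      · rw [if_neg h]
        simp only [PropForm.subst, fillSubst_zero]
        rw [colOR_end (by omega)]
    · -- the lower edge `c(u+1,w)`
      have hau : a ≠ u := fun h => by have := congrArg Fin.val h; omega
      have e1 : skelOf k u b (Sum.inr (a, b)) = var 2 := by simp [skelOf, hau, ha]
      rw [e1]
      simp only [PropForm.subst, fillSubst_two, routeOf]
      rw [ha]

/-- The same on variable numbers: on the variables of the equation of `g(u,w)`,
`(skelSubst x).subst fillSubst = routeSubst x`. [folklore] -/
theorem subst_skelSubst_fillSubst (u : Fin (k + 2)) (w : Fin (k + 1)) {e : VarIdx k}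
    (he : e ∈ edgesOf k (Sum.inr (Sum.inr (u, w)))) :
    (skelSubst k u w (varEquiv k e)).subst (fillSubst k u w) = routeSubst k (varEquiv k e) := by
  rw [skelSubst_varEquiv, routeSubst_varEquiv, subst_skelOf_fillSubst u w he]

/-! ### The clauses of an equation, and the skeleton tautologies -/

/-- Block values for `B = 1`: the value of the variable itself. [folklore] -/
theorem blockVals_one {n : ℕ} (τ : ℕ → Bool) (j : Fin n) :
    blockVals 2 1 n τ j = if τ j then 1 else 0 := by
  simp only [blockVals, blockVal, encBlock, xorBlock, List.range_one, List.map_cons,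
    List.map_nil, mul_one, add_zero]
  by_cases h : τ j <;> simp [h]

/-- The variables of a clause of the equation of row `r` are (numbers of) edges of `r`.
[folklore] -/
theorem exists_edge_of_mem_equationCNF {r : RowIdx k} {K : Clause ℕ}
    (hK : K ∈ equationCNF 1 (gridSystem k (rowEquiv k r))) {l : Literal ℕ} (hl : l ∈ K) :
    ∃ e ∈ edgesOf k r, l.1 = (varEquiv k e : ℕ) := by
  have hv : l.1 ∈ eqVars 1 (gridSystem k (rowEquiv k r)) := fst_mem_of_mem_canonicalCNF hK hl
  obtain ⟨i, hi, hvi⟩ := mem_eqVars.1 hv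
  obtain ⟨j, hj, hij⟩ := mem_encBlock.1 hvi
  rw [supp_gridSystem, Finset.mem_map_equiv] at hi
  refine ⟨(varEquiv k).symm i, hi, ?_⟩
  simp only [Equiv.apply_symm_apply]
  omega

/-- A clause of the equation of row `r` is true under any assignment solving that equation.
[folklore] -/
theorem any_eq_true_of_holds {r : RowIdx k} {K : Clause ℕ}
    (hK : K ∈ equationCNF 1 (gridSystem k (rowEquiv k r))) {τ : ℕ → Bool}
    (hτ : (gridSystem k (rowEquiv k r)).Holds (blockVals 2 1 (nVars k) τ)) :
    K.any (Literal.eval τ) = true := by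
  have h := eval_equationCNF 1 (gridSystem k (rowEquiv k r)) τ
  rw [decide_eq_true hτ, CNF.eval_eq_true_iff] at h
  exact h K hK

/-- Sums over the edges of a grid point, explicitly. [folklore] -/
theorem sum_edgesOf_grid {M : Type*} [AddCommMonoid M] (u : Fin (k + 2)) (w : Fin (k + 1))
    (f : VarIdx k → M) :
    ∑ e ∈ edgesOf k (Sum.inr (Sum.inr (u, w))), f e =
      f (Sum.inl (u, w)) + f (Sum.inr (u, w)) +
      (if h : (w : ℕ) + 1 < k + 1 then f (Sum.inl (u, ⟨w + 1, h⟩)) else 0) +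
      (if h : (u : ℕ) + 1 < k + 2 then f (Sum.inr (⟨u + 1, h⟩, w)) else 0) := by
  simp only [edgesOf]
  rw [Finset.sum_union, Finset.sum_union, Finset.sum_pair (by simp)]
  · congr 1
    · congr 1
      split_ifs <;> simp
    · split_ifs <;> simp
  · rw [Finset.disjoint_left]
    intro e he
    simp only [Finset.mem_insert, Finset.mem_singleton] at he
    rcases he with rfl | rfl
    · split_ifs with h
      · simp only [Finset.mem_singleton, Sum.inl.injEq, Prod.mk.injEq, true_and]
        intro heq; have := congrArg Fin.val heq; simp at this
      · simp
    · split_ifs <;> simp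
  · rw [Finset.disjoint_left]
    intro e he
    simp only [Finset.mem_union, Finset.mem_insert, Finset.mem_singleton] at he
    rcases he with (rfl | rfl) | he
    · split_ifs <;> simp
    · split_ifs with h
      · simp only [Finset.mem_singleton, Sum.inr.injEq, Prod.mk.injEq, and_true]
        intro heq; have := congrArg Fin.val heq; simp at this
      · simp
    · split_ifs at he ⊢ with h1 h2 <;> simp_all

/-- Bool to `𝔽₂`. [folklore] -/
theorem ite_bool_or (a b : Bool) :
    (if (a || b) = true then (1 : ZMod 2) else 0) =
      (if a = true then 1 else 0) + (if b = true then 1 else 0) +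
        (if (a && b) = true then 1 else 0) := by
  cases a <;> cases b <;> decide

/-- **The skeleton tautology at a grid point.** If `¬(x₀ ∧ x₁)` and `¬(x₀ ∧ x₂)` hold under `τ`,
then every clause of the equation of `g(u,w)`, taken through the skeleton, is true under `τ`:
the skeleton edge values `x₀ ∨ x₁, x₁, x₀ ∨ x₂, x₂` (missing edges `⊥`) sum to `0`.
[Ben-Sasson 2002, §3 (the routing satisfies the Tseitin constraints)] [folklore] -/
theorem skel_tautology_grid (u : Fin (k + 2)) (w : Fin (k + 1)) {τ : ℕ → Bool}
    (h1 : ¬ (τ 0 = true ∧ τ 1 = true)) (h2 : ¬ (τ 0 = true ∧ τ 2 = true)) {K : Clause ℕ}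
    (hK : K ∈ equationCNF 1 (gridSystem k (rowEquiv k (Sum.inr (Sum.inr (u, w)))))) :
    ((clauseOf K).subst (skelSubst k u w)).eval τ = true := by
  rw [eval_subst, eval_clauseOf]
  refine any_eq_true_of_holds hK ?_
  rw [holds_gridSystem_iff, sum_edgesOf_grid]
  have e0 : ∀ e, blockVals 2 1 (nVars k) (fun x => (skelSubst k u w x).eval τ)
      (varEquiv k e) = if (skelOf k u w e).eval τ then 1 else 0 := fun e => by
    rw [blockVals_one, skelSubst_varEquiv]
  have hne1 : ∀ h : (w : ℕ) + 1 < k + 1, ¬ ((⟨(w : ℕ) + 1, h⟩ : Fin (k + 1)) = w) :=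
    fun h heq => by have := congrArg Fin.val heq; simp at this
  have hne2 : ∀ h : (u : ℕ) + 1 < k + 2, ¬ ((⟨(u : ℕ) + 1, h⟩ : Fin (k + 2)) = u) :=
    fun h heq => by have := congrArg Fin.val heq; simp at this
  simp only [e0, charge]
  by_cases hw : (w : ℕ) + 1 < k + 1 <;> by_cases hu : (u : ℕ) + 1 < k + 2 <;>
    simp only [hw, hu, dif_pos, dif_neg, not_false_eq_true, skelOf, and_self, if_true, true_and,
      hne1, hne2, if_false, false_and, PropForm.eval, add_zero] <;>
    revert h1 h2 <;> cases τ 0 <;> cases τ 1 <;> cases τ 2 <;> decide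

/-- **The skeleton tautology at a pigeon terminal.** If `x₀` holds then every clause of the
equation of `t_u`, with its edge `r(u,0) ↦ x₀`, is true (value `1 =` charge). [folklore] -/
theorem skel_tautology_pigeon (u : Fin (k + 2)) {τ : ℕ → Bool} (h0 : τ 0 = true) {K : Clause ℕ}
    (hK : K ∈ equationCNF 1 (gridSystem k (rowEquiv k (Sum.inl u)))) :
    ((clauseOf K).subst fun x => if x = (varEquiv k (Sum.inl (u, 0)) : ℕ) then var 0
      else const false).eval τ = true := by
  rw [eval_subst, eval_clauseOf]
  refine any_eq_true_of_holds hK ?_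
  rw [holds_gridSystem_iff]
  simp only [edgesOf, Finset.sum_singleton, charge]
  rw [blockVals_one]
  simp [PropForm.eval, h0]

/-- **The skeleton tautology at a hole terminal.** [folklore] -/
theorem skel_tautology_hole (w : Fin (k + 1)) {τ : ℕ → Bool} (h0 : τ 0 = true) {K : Clause ℕ}
    (hK : K ∈ equationCNF 1 (gridSystem k (rowEquiv k (Sum.inr (Sum.inl w))))) :
    ((clauseOf K).subst fun x => if x = (varEquiv k (Sum.inr (0, w)) : ℕ) then var 0
      else const false).eval τ = true := by
  rw [eval_subst, eval_clauseOf]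
  refine any_eq_true_of_holds hK ?_
  rw [holds_gridSystem_iff]
  simp only [edgesOf, Finset.sum_singleton, charge]
  rw [blockVals_one]
  simp [PropForm.eval, h0]

end Summit.PneNP.PneNP.Theorems.GridRouting
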